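import Summits.AnomalousDissipation.AnomalousDissipation.Theorems.MomentParityPathField
import Literature.Analysis.FluidPDE.StatisticalSolutionEnergyEq
import Literature.Analysis.FunctionSpaces.TorusFourierSeries

/-!
# Crux `EnsembleRealization` (stmt-AnomalousDissipation-0215) — line `augmented-lift`,
# sub-stub M2a `stub_augLimit`, tools part (ii): the energy inequality of the limit law

Supports stmt-AnomalousDissipation-0215 (sub-stub `stub_augLimit` of the reshaped stub
`stub_augmentedLaw`, line `augmented-lift`). Nothing here closes an item.
For a limit law `Q̃` on `𝒦(R, L) × [0, b]^ℚ` along which bounded continuous functionals keep their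
eventual upper bounds (`hle`), the ENERGY LINK of the level laws gives `Q̃`-a.s.
`e q' − e q + ∫_q^{q'} (2 pathDiss ν K − 2(f̂, ω̄)) ≤ 0` for all `K` and rationals `0 ≤ q ≤ q'`
(`ae_violation_nonpos`); the joint one-time laws identify the energy coordinate with the path
energy (`ae_energyCoord_eq`, the graph of Parseval on `H`); hence the path law a.s. satisfies the
path-level energy inequality (`ae_pathEnergyIneq`), which yields locally finite enstrophy and the
energy inequality between rational times for the `L²` field of the path
(`energyIneq_of_pathEnergyIneq`: monotone convergence `pathDiss ν K ↑ ν‖∇v‖²`, Parseval for the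
work). Main statement: `stub_augLimitEnergyTools`.
-/

noncomputable section

set_option linter.dupNamespace false

open MeasureTheory Set Filter Topology Function Metric UnitAddTorus
open scoped BigOperators ENNReal InnerProductSpace RealInnerProductSpace

namespace Summit.AnomalousDissipation.AnomalousDissipation.Theorems.EnsembleRealization

open Literature.Analysis.FunctionSpaces Literature.Analysis.FunctionSpaces.Torus
open Literature.Analysis.FluidPDE Literature.Analysis.FluidPDE.Torus
open Summit.AnomalousDissipation.AnomalousDissipation.Theorems.MomentParity

variable {ν : ℝ} {f : UnitAddTorus (Fin 3) → EuclideanSpace ℝ (Fin 3)}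
  {μ : Measure (Torus.energySpace (Fin 3))} {R : ℝ} {L : (Fin 3 → ℤ) → ℝ} {b : ℝ}

/-- Termwise bound for the spectral work density on `𝒦`: `|Re ⟪f̂ k, ω̄(τ, k)⟫| ≤ ‖f̂ k‖ |R|`. -/
theorem abs_re_inner_pathExt_le {ω : Path (Fin 3)} (hω : ω ∈ pathSpace R L) (τ : ℝ) (k : Fin 3 → ℤ) :
    |(⟪mFourierCoeff (EuclideanSpace.complexify ∘ f) k, pathExt ω τ k⟫_ℂ).re| ≤
      ‖mFourierCoeff (EuclideanSpace.complexify ∘ f) k‖ * |R| :=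
  (Complex.abs_re_le_norm _).trans ((norm_inner_le_norm _ _).trans
    (mul_le_mul_of_nonneg_left (norm_pathExt_le hω τ k) (norm_nonneg _)))

/-- **The spectral work density is jointly continuous on `𝒦 × ℝ`** for a smooth force (uniformly
convergent series of continuous functions: `∑ ‖f̂ k‖ < ∞`, `‖ω̄(τ, k)‖ ≤ |R|`). -/
theorem continuous_work (hf : IsSmooth f) (R : ℝ) (L : (Fin 3 → ℤ) → ℝ) :
    Continuous fun p : ↥(pathSpace R L : Set (Path (Fin 3))) × ℝ =>
      ∑' k : Fin 3 → ℤ, (⟪mFourierCoeff (EuclideanSpace.complexify ∘ f) k, pathExt p.1.1 p.2 k⟫_ℂ).re := by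
  refine continuous_tsum (fun k => ?_) ((summable_norm_mFourierCoeff_of_isSmooth hf).mul_right |R|)
    fun k p => ?_
  · exact (Complex.continuous_re.comp (continuous_const.inner (continuous_pathExt_subtype_prod R L k)))
  · rw [Real.norm_eq_abs]
    exact abs_re_inner_pathExt_le p.1.2 p.2 k

/-- **Parseval for the work**: for an `L²` field `w` with the coefficients `ω̄(τ, ·)` and
`f ∈ L²`, `(f̂, ω̄(τ)) = ∫ ⟪f, w⟫`. -/
theorem work_eq_integral_inner (hf : MemLp f 2 volume) {ω : Path (Fin 3)} {τ : ℝ}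
    {w : UnitAddTorus (Fin 3) → EuclideanSpace ℝ (Fin 3)} (hw : MemLp w 2 volume)
    (hcoef : ∀ k, mFourierCoeff (EuclideanSpace.complexify ∘ w) k = pathExt ω τ k) :
    ∑' k : Fin 3 → ℤ, (⟪mFourierCoeff (EuclideanSpace.complexify ∘ f) k, pathExt ω τ k⟫_ℂ).re =
      ∫ x, ⟪f x, w x⟫_ℝ := by
  have h := hasSum_re_inner_mFourierCoeff_complexify hf hw
  simp only [hcoef] at h
  exact h.tsum_eq

/-- **The violation functional is continuous on the augmented trajectory space** (evaluations of
the energy coordinate, and a parametric interval integral of a jointly continuous integrand). -/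
theorem continuous_violation (hf : IsSmooth f) (ν : ℝ) (K : ℕ) (q q' : ℚ) :
    Continuous fun x : ↥(pathSpace R L : Set (Path (Fin 3))) × ↥((Set.univ : Set ℚ).pi fun _ : ℚ => Set.Icc (0 : ℝ) b) => max 0 (x.2.1 q' - x.2.1 q +
          ∫ τ in (q : ℝ)..q',
      (2 * pathDiss ν K x.1.1 τ - 2 * (∑' k : Fin 3 → ℤ, (⟪mFourierCoeff (EuclideanSpace.complexify ∘ f) k, pathExt x.1.1 τ k⟫_ℂ).re))) := by
  have ha : Continuous fun x : ↥(pathSpace R L : Set (Path (Fin 3))) × ↥((Set.univ : Set ℚ).pi fun _ : ℚ => Set.Icc (0 : ℝ) b) => x.2.1 q' :=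
    (continuous_apply q').comp (continuous_subtype_val.comp continuous_snd)
  have hb : Continuous fun x : ↥(pathSpace R L : Set (Path (Fin 3))) × ↥((Set.univ : Set ℚ).pi fun _ : ℚ => Set.Icc (0 : ℝ) b) => x.2.1 q :=
    (continuous_apply q).comp (continuous_subtype_val.comp continuous_snd)
  have hj : Continuous fun p : (↥(pathSpace R L : Set (Path (Fin 3))) × ↥((Set.univ : Set ℚ).pi fun _ : ℚ => Set.Icc (0 : ℝ) b)) × ℝ => 2 * pathDiss
        ν K p.1.1.1 p.2 - 2 * (∑' k : Fin 3 → ℤ, (⟪mFourierCoeff (EuclideanSpace.complexify ∘ f) k, pathExt p.1.1.1 p.2 k⟫_ℂ).re) := by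
    have h1 : Continuous fun p : (↥(pathSpace R L : Set (Path (Fin 3))) × ↥((Set.univ : Set ℚ).pi fun _ : ℚ => Set.Icc (0 : ℝ) b)) × ℝ => ((p.1.1,
          p.2) : ↥(pathSpace R L : Set (Path (Fin 3))) × ℝ) :=
      (continuous_fst.comp continuous_fst).prodMk continuous_snd
    have h2 := (continuous_pathDiss R L ν K).comp h1
    have h3 := (continuous_work hf R L).comp h1
    exact (continuous_const.mul h2).sub (continuous_const.mul h3)
  have hc : Continuous fun x : ↥(pathSpace R L : Set (Path (Fin 3))) × ↥((Set.univ : Set ℚ).pi fun _ : ℚ => Set.Icc (0 : ℝ) b) => ∫ τ in (q : ℝ)..q',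
        (2 * pathDiss ν K x.1.1 τ - 2 * (∑' k : Fin 3 → ℤ, (⟪mFourierCoeff (EuclideanSpace.complexify ∘ f) k, pathExt x.1.1 τ k⟫_ℂ).re)) :=
    intervalIntegral.continuous_parametric_intervalIntegral_of_continuous' hj _ _
  have hd : Continuous fun x : ↥(pathSpace R L : Set (Path (Fin 3))) × ↥((Set.univ : Set ℚ).pi fun _ : ℚ => Set.Icc (0 : ℝ) b) => x.2.1 q' - x.2.1 q +
      ∫ τ in (q : ℝ)..q', (2 * pathDiss ν K x.1.1 τ - 2 * (∑' k : Fin 3 → ℤ, (⟪mFourierCoeff (EuclideanSpace.complexify ∘ f) k, pathExt x.1.1 τ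
            k⟫_ℂ).re)) := (ha.sub hb).add hc
  exact continuous_const.max hd

/-- A continuous real function on the (compact) augmented trajectory space is bounded. -/
theorem exists_abs_le_of_continuous {g : ↥(pathSpace R L : Set (Path (Fin 3))) × ↥((Set.univ : Set ℚ).pi fun _ : ℚ => Set.Icc (0 : ℝ) b) → ℝ} (hg :
      Continuous g) : ∃ B : ℝ, ∀ x, |g x| ≤ B := by
  haveI := compactSpace_pathSpace (d := Fin 3) R L
  haveI : CompactSpace ↥((Set.univ : Set ℚ).pi fun _ : ℚ => Set.Icc (0 : ℝ) b) := isCompact_iff_compactSpace.1 (isCompact_univ_pi fun _ => isCompact_Icc)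
  obtain ⟨B, hB⟩ := isCompact_univ.exists_bound_of_continuousOn hg.continuousOn
  exact ⟨B, fun x => by rw [← Real.norm_eq_abs]; exact hB x (mem_univ x)⟩

/-- **The violation functionals vanish almost surely under the limit law**: their means are `≤ 0`
(eventual upper bounds `γ` pass to the limit) and they are nonnegative and continuous. -/
theorem ae_violation_nonpos (hf : IsSmooth f) (Qt : Measure (↥(pathSpace R L : Set (Path (Fin 3))) × ↥((Set.univ : Set ℚ).pi fun _ : ℚ => Set.Icc (0
      : ℝ) b))) [IsFiniteMeasure Qt]
    {P : ℕ → Measure (↥(pathSpace R L : Set (Path (Fin 3))) × ↥((Set.univ : Set ℚ).pi fun _ : ℚ => Set.Icc (0 : ℝ) b))}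
    (hle : ∀ g : ↥(pathSpace R L : Set (Path (Fin 3))) × ↥((Set.univ : Set ℚ).pi fun _ : ℚ => Set.Icc (0 : ℝ) b) → ℝ, Continuous g → ∀ B : ℝ, (∀ x,
          |g x| ≤ B) → ∀ C : ℝ,
      (∀ γ : ℝ, 0 < γ → ∀ᶠ n in atTop, ∫ x, g x ∂(P n) ≤ C + γ) → ∫ x, g x ∂Qt ≤ C)
    (henergy : ∀ (K : ℕ) (q q' : ℚ), 0 ≤ q → q ≤ q' → ∀ γ : ℝ, 0 < γ → ∀ᶠ n in atTop,
      ∫ x, max 0 (x.2.1 q' - x.2.1 q + ∫ τ in (q : ℝ)..q',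
          (2 * pathDiss ν K x.1.1 τ - 2 * (∑' k : Fin 3 → ℤ, (⟪mFourierCoeff (EuclideanSpace.complexify ∘ f) k, pathExt x.1.1 τ k⟫_ℂ).re))) ∂(P n) ≤ γ) :
    ∀ᵐ x ∂Qt, ∀ (K : ℕ) (q q' : ℚ), 0 ≤ q → q ≤ q' →
      x.2.1 q' - x.2.1 q + ∫ τ in (q : ℝ)..q', (2 * pathDiss ν K x.1.1 τ - 2 * (∑' k : Fin 3 → ℤ, (⟪mFourierCoeff (EuclideanSpace.complexify ∘ f) k,
            pathExt x.1.1 τ k⟫_ℂ).re)) ≤ 0 := by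
  rw [ae_all_iff]; intro K; rw [ae_all_iff]; intro q; rw [ae_all_iff]; intro q'
  by_cases hq : 0 ≤ q
  swap; · exact ae_of_all _ fun x h => absurd h hq
  by_cases hqq : q ≤ q'
  swap; · exact ae_of_all _ fun x _ h => absurd h hqq
  set g : ↥(pathSpace R L : Set (Path (Fin 3))) × ↥((Set.univ : Set ℚ).pi fun _ : ℚ => Set.Icc (0 : ℝ) b) → ℝ := fun x => max 0 (x.2.1 q' - x.2.1 q +
        ∫ τ in (q : ℝ)..q',
    (2 * pathDiss ν K x.1.1 τ - 2 * (∑' k : Fin 3 → ℤ, (⟪mFourierCoeff (EuclideanSpace.complexify ∘ f) k, pathExt x.1.1 τ k⟫_ℂ).re))) with hg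
  have hgc : Continuous g := continuous_violation hf ν K q q'
  obtain ⟨B, hB⟩ := exists_abs_le_of_continuous hgc
  have hg0 : 0 ≤ g := fun x => le_max_left _ _
  have hgi : Integrable g Qt := Integrable.of_bound hgc.aestronglyMeasurable B
    (ae_of_all _ fun x => by rw [Real.norm_eq_abs]; exact hB x)
  have hint : ∫ x, g x ∂Qt ≤ 0 := hle g hgc B hB 0 fun γ hγ => by
    simpa only [zero_add] using henergy K q q' hq hqq γ hγ
  filter_upwards [(integral_eq_zero_iff_of_nonneg hg0 hgi).1 (le_antisymm hint (integral_nonneg hg0))]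
    with x hx _ _ using max_eq_left_iff.1 hx

/-- **The graph identity**: under a law on `𝒦 × [0, b]^ℚ` whose joint one-time law at the
rational time `q ≥ 0` is the law of `(û, ‖u‖²)` under a finite measure on `H`, almost surely
`e q = ∑' ‖ω(q, ·)‖² = pathEnergyTot ω q` (Parseval `‖u‖² = ∑' ‖û k‖²` on `H` transported
through the joint law). -/
theorem ae_energyCoord_eq [IsFiniteMeasure μ] (Qt : Measure (↥(pathSpace R L : Set (Path (Fin 3))) × ↥((Set.univ : Set ℚ).pi fun _ : ℚ => Set.Icc (0 : ℝ) b)))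
    (hjoint : ∀ q : ℚ, 0 ≤ q →
      Qt.map (fun x => ((fun k : Fin 3 → ℤ => x.1.1 (q, k)), x.2.1 q)) =
        μ.map (fun u : Torus.energySpace (Fin 3) => ((fun k : Fin 3 → ℤ =>
          mFourierCoeff (EuclideanSpace.complexify ∘ (u.1 : UnitAddTorus (Fin 3) → EuclideanSpace ℝ (Fin 3))) k),
          ‖u‖ ^ 2))) :
    ∀ᵐ x ∂Qt, ∀ q : ℚ, 0 ≤ q → x.2.1 q = pathEnergyTot x.1.1 q := by
  rw [ae_all_iff]; intro q
  by_cases hq : 0 ≤ q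
  swap; · exact ae_of_all _ fun x h => absurd h hq
  -- the graph of Parseval in the one-time state space
  set h : ((Fin 3 → ℤ) → EuclideanSpace ℂ (Fin 3)) × ℝ → ℝ := fun z => (∑' k, ‖z.1 k‖ₑ ^ 2).toReal with hh
  have hhm : Measurable h :=
    (Measurable.tsum fun k => ((measurable_pi_apply k).comp measurable_fst).enorm.pow_const 2).ennreal_toReal
  have hS : MeasurableSet {z : ((Fin 3 → ℤ) → EuclideanSpace ℂ (Fin 3)) × ℝ | z.2 = h z} :=
    measurableSet_eq_fun measurable_snd hhm
  have hJ : Measurable fun x : ↥(pathSpace R L : Set (Path (Fin 3))) × ↥((Set.univ : Set ℚ).pi fun _ : ℚ => Set.Icc (0 : ℝ) b) => ((fun k : Fin 3 → ℤ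
        => x.1.1 (q, k)), x.2.1 q) := by
    refine (measurable_pi_lambda _ fun k => ?_).prodMk ?_
    · exact (measurable_pi_apply (q, k)).comp (measurable_subtype_coe.comp measurable_fst)
    · exact (measurable_pi_apply q).comp (measurable_subtype_coe.comp measurable_snd)
  have hG : Measurable fun u : Torus.energySpace (Fin 3) => ((fun k : Fin 3 → ℤ =>
      mFourierCoeff (EuclideanSpace.complexify ∘ (u.1 : UnitAddTorus (Fin 3) → EuclideanSpace ℝ (Fin 3))) k),
      ‖u‖ ^ 2) :=
    (measurable_pi_lambda _ fun k =>
      ((continuous_mFourierCoeff_complexify_coe k).comp continuous_subtype_val).measurable).prodMk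
      (continuous_norm.pow 2).measurable
  -- every field of `H` lies on the graph
  have hμS : ∀ᵐ z ∂(μ.map fun u : Torus.energySpace (Fin 3) => ((fun k : Fin 3 → ℤ =>
      mFourierCoeff (EuclideanSpace.complexify ∘ (u.1 : UnitAddTorus (Fin 3) → EuclideanSpace ℝ (Fin 3))) k),
      ‖u‖ ^ 2)), z.2 = h z := by
    refine (ae_map_iff hG.aemeasurable hS).2 (ae_of_all _ fun u => ?_)
    simp only [hh]
    have hn : ‖u‖ₑ = ‖(u.1 : Lp (EuclideanSpace ℝ (Fin 3)) 2 (volume : Measure (UnitAddTorus (Fin 3))))‖ₑ := rfl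
    rw [← enorm_sq_coe_eq_tsum, ← hn, ← ofReal_norm, ← ENNReal.ofReal_pow (norm_nonneg _),
      ENNReal.toReal_ofReal (sq_nonneg _)]
  rw [← hjoint q hq] at hμS
  filter_upwards [(ae_map_iff hJ.aemeasurable hS).1 hμS] with x hx _
  rw [hx]
  simp only [hh, pathEnergyTot]
  rw [← ENNReal.toReal_ofReal (tsum_nonneg fun k => sq_nonneg ‖pathExt x.1.1 (q : ℝ) k‖),
    ENNReal.ofReal_tsum_of_nonneg (fun _ => sq_nonneg _) (summable_norm_pathExt_sq x.1.2 _)]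
  congr 1
  exact tsum_congr fun k => by rw [pathExt_ratCast x.1.2 hq, enorm_sq_eq_ofReal_norm_sq]

/-- The set of paths satisfying the path-level energy inequalities is measurable. -/
theorem measurableSet_pathEnergyIneq (hf : IsSmooth f) (ν R : ℝ) (L : (Fin 3 → ℤ) → ℝ) :
    MeasurableSet {ω : ↥(pathSpace R L : Set (Path (Fin 3))) | ∀ (K : ℕ) (q q' : ℚ), 0 ≤ q → q ≤ q' →
      pathEnergyTot ω.1 q' - pathEnergyTot ω.1 q +
        ∫ τ in (q : ℝ)..q', (2 * pathDiss ν K ω.1 τ - 2 * (∑' k : Fin 3 → ℤ, (⟪mFourierCoeff (EuclideanSpace.complexify ∘ f) k, pathExt ω.1 τ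
              k⟫_ℂ).re)) ≤ 0} := by
  have hE : ∀ t : ℝ, Measurable fun ω : ↥(pathSpace R L : Set (Path (Fin 3))) => pathEnergyTot ω.1 t := by
    intro t
    have h := (measurable_pathEnergyTot R L).comp
      ((measurable_id (α := ↥(pathSpace R L : Set (Path (Fin 3))))).prodMk (measurable_const (a := t)))
    exact h
  have hI : ∀ (K : ℕ) (q q' : ℚ), Continuous fun ω : ↥(pathSpace R L : Set (Path (Fin 3))) =>
      ∫ τ in (q : ℝ)..q', (2 * pathDiss ν K ω.1 τ - 2 * (∑' k : Fin 3 → ℤ, (⟪mFourierCoeff (EuclideanSpace.complexify ∘ f) k, pathExt ω.1 τ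
            k⟫_ℂ).re)) := fun K q q' => by
    have hj : Continuous fun p : ↥(pathSpace R L : Set (Path (Fin 3))) × ℝ =>
        2 * pathDiss ν K p.1.1 p.2 - 2 * (∑' k : Fin 3 → ℤ, (⟪mFourierCoeff (EuclideanSpace.complexify ∘ f) k, pathExt p.1.1 p.2 k⟫_ℂ).re) :=
      (continuous_const.mul (continuous_pathDiss R L ν K)).sub (continuous_const.mul (continuous_work hf R L))
    exact intervalIntegral.continuous_parametric_intervalIntegral_of_continuous' hj _ _
  have hF : ∀ (K : ℕ) (q q' : ℚ), Measurable fun ω : ↥(pathSpace R L : Set (Path (Fin 3))) =>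
      pathEnergyTot ω.1 q' - pathEnergyTot ω.1 q +
        ∫ τ in (q : ℝ)..q', (2 * pathDiss ν K ω.1 τ - 2 * (∑' k : Fin 3 → ℤ, (⟪mFourierCoeff (EuclideanSpace.complexify ∘ f) k, pathExt ω.1 τ
              k⟫_ℂ).re)) := fun K q q' =>
    ((hE q').sub (hE q)).add (hI K q q').measurable
  simp only [setOf_forall]
  refine MeasurableSet.iInter fun K => MeasurableSet.iInter fun q => MeasurableSet.iInter fun q' =>
    MeasurableSet.iInter fun _ => MeasurableSet.iInter fun _ => ?_
  exact measurableSet_le (hF K q q') measurable_const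

/-- **The path law satisfies the path-level energy inequalities almost surely**:
`∑'‖ω̄(q')‖² − ∑'‖ω̄(q)‖² + ∫_q^{q'} (2 pathDiss ν K − 2 (f̂, ω̄)) ≤ 0` for all `K` and all rational
`0 ≤ q ≤ q'`. -/
theorem ae_pathEnergyIneq (hf : IsSmooth f) [IsFiniteMeasure μ] (Qt : Measure (↥(pathSpace R L : Set (Path (Fin 3))) × ↥((Set.univ : Set ℚ).pi fun _
      : ℚ => Set.Icc (0 : ℝ) b))) [IsFiniteMeasure Qt]
    {P : ℕ → Measure (↥(pathSpace R L : Set (Path (Fin 3))) × ↥((Set.univ : Set ℚ).pi fun _ : ℚ => Set.Icc (0 : ℝ) b))}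
    (hle : ∀ g : ↥(pathSpace R L : Set (Path (Fin 3))) × ↥((Set.univ : Set ℚ).pi fun _ : ℚ => Set.Icc (0 : ℝ) b) → ℝ, Continuous g → ∀ B : ℝ, (∀ x,
          |g x| ≤ B) → ∀ C : ℝ,
      (∀ γ : ℝ, 0 < γ → ∀ᶠ n in atTop, ∫ x, g x ∂(P n) ≤ C + γ) → ∫ x, g x ∂Qt ≤ C)
    (hjoint : ∀ q : ℚ, 0 ≤ q →
      Qt.map (fun x => ((fun k : Fin 3 → ℤ => x.1.1 (q, k)), x.2.1 q)) =
        μ.map (fun u : Torus.energySpace (Fin 3) => ((fun k : Fin 3 → ℤ =>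
          mFourierCoeff (EuclideanSpace.complexify ∘ (u.1 : UnitAddTorus (Fin 3) → EuclideanSpace ℝ (Fin 3))) k),
          ‖u‖ ^ 2)))
    (henergy : ∀ (K : ℕ) (q q' : ℚ), 0 ≤ q → q ≤ q' → ∀ γ : ℝ, 0 < γ → ∀ᶠ n in atTop,
      ∫ x, max 0 (x.2.1 q' - x.2.1 q + ∫ τ in (q : ℝ)..q',
          (2 * pathDiss ν K x.1.1 τ - 2 * (∑' k : Fin 3 → ℤ, (⟪mFourierCoeff (EuclideanSpace.complexify ∘ f) k, pathExt x.1.1 τ k⟫_ℂ).re))) ∂(P n) ≤ γ) :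
    ∀ᵐ ω ∂(Qt.map Prod.fst), ∀ (K : ℕ) (q q' : ℚ), 0 ≤ q → q ≤ q' →
      pathEnergyTot ω.1 q' - pathEnergyTot ω.1 q +
        ∫ τ in (q : ℝ)..q', (2 * pathDiss ν K ω.1 τ - 2 * (∑' k : Fin 3 → ℤ, (⟪mFourierCoeff (EuclideanSpace.complexify ∘ f) k, pathExt ω.1 τ
              k⟫_ℂ).re)) ≤ 0 := by
  refine (ae_map_iff measurable_fst.aemeasurable (measurableSet_pathEnergyIneq hf ν R L)).2 ?_
  filter_upwards [ae_violation_nonpos hf Qt hle henergy, ae_energyCoord_eq Qt hjoint] with x h1 h2 K q q' hq hqq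
  have h := h1 K q q' hq hqq
  rwa [h2 q hq, h2 q' (hq.trans hqq)] at h

/-- The resolved dissipation in `ℝ≥0∞`:
`ofReal (pathDiss ν K ω τ) = ofReal ν · ofReal 4π² · ∑_{|k| ≤ K} ofReal |k|² ‖ω̄(τ, k)‖ₑ²`. -/
theorem ofReal_pathDiss {ν : ℝ} (hν : 0 ≤ ν) (K : ℕ) (ω : Path (Fin 3)) (τ : ℝ) :
    ENNReal.ofReal (pathDiss ν K ω τ) = ENNReal.ofReal ν * (ENNReal.ofReal (4 * Real.pi ^ 2) *
      ∑ k ∈ freqBall K, ENNReal.ofReal (freqNormSq k) * ‖pathExt ω τ k‖ₑ ^ 2) := by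
  have h0 : ∀ k : Fin 3 → ℤ, 0 ≤ freqNormSq k * ‖pathExt ω τ k‖ ^ 2 := fun k =>
    mul_nonneg (freqNormSq_nonneg k) (sq_nonneg _)
  rw [pathDiss, ENNReal.ofReal_mul hν, ENNReal.ofReal_mul (by positivity),
    ENNReal.ofReal_sum_of_nonneg fun k _ => h0 k]
  congr 2
  exact Finset.sum_congr rfl fun k _ => by
    rw [ENNReal.ofReal_mul (freqNormSq_nonneg k), enorm_sq_eq_ofReal_norm_sq]

/-- **Monotone convergence of the resolved dissipation along a path**: for the `L²` field `v` of
a path `ω ∈ 𝒦` (`𝓕(v τ) = ω̄(τ)`, `τ ≥ 0`), `ν ≥ 0` and `0 ≤ s ≤ t`,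
`ofReal ν · ∫⁻_{(s,t)} ‖∇v‖² = ⨆_K ofReal (∫_s^t pathDiss ν K ω)` (`eGradNormSq_eq_tsum`). -/
theorem mul_lintegral_eGradNormSq_eq_iSup {ν : ℝ} (hν : 0 ≤ ν) {ω : Path (Fin 3)} (hω : ω ∈ pathSpace R L)
    {v : ℝ → UnitAddTorus (Fin 3) → EuclideanSpace ℝ (Fin 3)}
    (hcoef : ∀ t, 0 ≤ t → MemLp (v t) 2 volume ∧
      ∀ k, mFourierCoeff (EuclideanSpace.complexify ∘ v t) k = pathExt ω t k)
    {s t : ℝ} (hs : 0 ≤ s) (hst : s ≤ t) :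
    ENNReal.ofReal ν * ∫⁻ τ in Ioo s t, eGradNormSq (v τ) =
      ⨆ K : ℕ, ENNReal.ofReal (∫ τ in s..t, pathDiss ν K ω τ) := by
  set g : ℕ → ℝ → ℝ≥0∞ := fun K τ => ENNReal.ofReal (pathDiss ν K ω τ) with hg
  have hgm : ∀ K, Measurable (g K) := fun K =>
    (((continuous_pathDiss R L ν K).comp (Continuous.prodMk_right (⟨ω, hω⟩ : ↥(pathSpace R L)))).measurable
      ).ennreal_ofReal
  have hgmono : Monotone g := fun K K' hKK' τ => by
    simp only [hg]
    refine ENNReal.ofReal_le_ofReal (mul_le_mul_of_nonneg_left (mul_le_mul_of_nonneg_left ?_ (by positivity)) hν)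
    exact Finset.sum_le_sum_of_subset_of_nonneg (freqBall_mono hKK') fun k _ _ =>
      mul_nonneg (freqNormSq_nonneg k) (sq_nonneg _)
  -- pointwise: the truncations exhaust `ν ‖∇v τ‖²`
  have hpt : ∀ τ, 0 ≤ τ → (⨆ K, g K τ) = ENNReal.ofReal ν * eGradNormSq (v τ) := by
    intro τ hτ
    rw [eGradNormSq_eq_tsum]
    simp only [hg, ofReal_pathDiss hν, (hcoef τ hτ).2]
    rw [← ENNReal.mul_iSup, ← ENNReal.mul_iSup]
    congr 2
    refine iSup_eq_of_tendsto (fun K K' hKK' => Finset.sum_le_sum_of_subset (freqBall_mono hKK')) ?_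
    exact ENNReal.summable.hasSum.comp tendsto_freqBall_atTop
  -- the interval integrals as lower integrals over `Ioo s t`
  have hint : ∀ K, ENNReal.ofReal (∫ τ in s..t, pathDiss ν K ω τ) = ∫⁻ τ in Ioo s t, g K τ := by
    intro K
    rw [intervalIntegral.integral_of_le hst, ← Measure.restrict_congr_set Ioo_ae_eq_Ioc,
      ofReal_integral_eq_lintegral_ofReal]
    · exact ((continuous_pathDiss R L ν K).comp
        (Continuous.prodMk_right (⟨ω, hω⟩ : ↥(pathSpace R L)))).integrableOn_Icc.mono_set Ioo_subset_Icc_self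
    · exact ae_of_all _ fun τ => pathDiss_nonneg hν K ω τ
  simp only [hint]
  rw [← lintegral_iSup hgm hgmono, ← lintegral_const_mul'' _
    (aemeasurable_eGradNormSq_pathField (s := 0) hω (fun t ht k => by rw [zero_add]; exact (hcoef t ht).2 k)
      (fun τ hτ => hs.trans hτ.1.le) measurableSet_Ioo)]
  refine setLIntegral_congr_fun measurableSet_Ioo fun τ hτ => ?_
  rw [← hpt τ (hs.trans hτ.1.le)]

/-- **The energy inequality of the field of a path from the path-level inequality.** If along
`ω ∈ 𝒦(R, L)` the path-level energy inequalities
`∑'‖ω̄(t)‖² − ∑'‖ω̄(s)‖² + ∫_s^t (2 pathDiss ν K − 2 (f̂, ω̄)) ≤ 0` hold for every truncation `K`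
(`0 ≤ s ≤ t`, `ν > 0`, `f` smooth), then the `L²` field `v` of the path has finite enstrophy on
`(s, t)` and `E(v t) + ν ∫_s^t ‖∇v‖² ≤ E(v s) + ∫_s^t (f, v)` (monotone convergence in `K`,
Parseval for energy and work). -/
theorem energyIneq_of_pathEnergyIneq (hν : 0 < ν) (hf : IsSmooth f) {ω : Path (Fin 3)} (hω : ω ∈ pathSpace R L)
    {v : ℝ → UnitAddTorus (Fin 3) → EuclideanSpace ℝ (Fin 3)}
    (hcoef : ∀ t, 0 ≤ t → MemLp (v t) 2 volume ∧
      ∀ k, mFourierCoeff (EuclideanSpace.complexify ∘ v t) k = pathExt ω t k)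
    {s t : ℝ} (hs : 0 ≤ s) (hst : s ≤ t)
    (hEP : ∀ K : ℕ, pathEnergyTot ω t - pathEnergyTot ω s +
      ∫ τ in s..t, (2 * pathDiss ν K ω τ - 2 * (∑' k : Fin 3 → ℤ, (⟪mFourierCoeff (EuclideanSpace.complexify ∘ f) k, pathExt ω τ k⟫_ℂ).re)) ≤ 0) :
    ∫⁻ τ in Ioo s t, eGradNormSq (v τ) < ∞ ∧
      kineticEnergy (v t) + ν * (∫⁻ τ in Ioo s t, eGradNormSq (v τ)).toReal ≤
        kineticEnergy (v s) + ∫ τ in s..t, ∫ x, ⟪f x, v τ x⟫_ℝ := by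
  have hWc : Continuous fun τ : ℝ => (∑' k : Fin 3 → ℤ, (⟪mFourierCoeff (EuclideanSpace.complexify ∘ f) k, pathExt ω τ k⟫_ℂ).re) := by
    have h := (continuous_work hf R L).comp (Continuous.prodMk_right (⟨ω, hω⟩ : ↥(pathSpace R L)))
    exact h
  have hDi : ∀ K, IntervalIntegrable (fun τ => pathDiss ν K ω τ) volume s t := fun K =>
    intervalIntegrable_pathDiss hω ν K s t
  have hWi : IntervalIntegrable (fun τ => (∑' k : Fin 3 → ℤ, (⟪mFourierCoeff (EuclideanSpace.complexify ∘ f) k, pathExt ω τ k⟫_ℂ).re)) volume s t :=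
        hWc.intervalIntegrable s t
  -- the path-level inequality, split
  set M : ℝ := (pathEnergyTot ω s - pathEnergyTot ω t) / 2 + ∫ τ in s..t, (∑' k : Fin 3 → ℤ, (⟪mFourierCoeff (EuclideanSpace.complexify ∘ f) k,
        pathExt ω τ k⟫_ℂ).re) with hM
  have hK : ∀ K : ℕ, ∫ τ in s..t, pathDiss ν K ω τ ≤ M := by
    intro K
    have h := hEP K
    rw [intervalIntegral.integral_sub ((hDi K).const_mul 2) (hWi.const_mul 2),
      intervalIntegral.integral_const_mul, intervalIntegral.integral_const_mul] at h
    simp only [hM]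
    linarith
  have hM0 : 0 ≤ M := (intervalIntegral.integral_nonneg hst fun τ _ => pathDiss_nonneg hν.le 0 ω τ).trans (hK 0)
  -- monotone convergence
  have hsup := mul_lintegral_eGradNormSq_eq_iSup hν.le hω hcoef hs hst
  have hle : ENNReal.ofReal ν * ∫⁻ τ in Ioo s t, eGradNormSq (v τ) ≤ ENNReal.ofReal M := by
    rw [hsup]
    exact iSup_le fun K => ENNReal.ofReal_le_ofReal (hK K)
  have hν0 : ENNReal.ofReal ν ≠ 0 := (ENNReal.ofReal_pos.2 hν).ne'
  have hfin : ∫⁻ τ in Ioo s t, eGradNormSq (v τ) ≠ ∞ := by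
    intro htop
    rw [htop, ENNReal.mul_top hν0] at hle
    exact absurd hle (not_le.2 ENNReal.ofReal_lt_top)
  refine ⟨lt_top_iff_ne_top.2 hfin, ?_⟩
  have hνD : ν * (∫⁻ τ in Ioo s t, eGradNormSq (v τ)).toReal ≤ M := by
    have h := ENNReal.toReal_le_of_le_ofReal hM0 hle
    rwa [ENNReal.toReal_mul, ENNReal.toReal_ofReal hν.le] at h
  -- Parseval for the energies and the work
  have hE : ∀ τ, 0 ≤ τ → kineticEnergy (v τ) = 2⁻¹ * pathEnergyTot ω τ := fun τ hτ => by
    rw [kineticEnergy, integral_norm_sq_eq_pathEnergyTot (hcoef τ hτ).1 (hcoef τ hτ).2]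
  have hW : ∫ τ in s..t, (∑' k : Fin 3 → ℤ, (⟪mFourierCoeff (EuclideanSpace.complexify ∘ f) k, pathExt ω τ k⟫_ℂ).re) = ∫ τ in s..t, ∫ x, ⟪f x, v τ x⟫_ℝ := by
    refine intervalIntegral.integral_congr fun τ hτ => ?_
    rw [uIcc_of_le hst] at hτ
    exact work_eq_integral_inner (hf.memLp 2) (hcoef τ (hs.trans hτ.1)).1 (hcoef τ (hs.trans hτ.1)).2
  rw [hE t (hs.trans hst), hE s hs, ← hW]
  simp only [hM] at hνD
  linarith

/-- **Tools stub (to be registered as `stub_augLimitEnergyTools`): the energy inequality of the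
limit law.** Let `Q̃` be a finite law on `𝒦(R, L) × [0, b]^ℚ` along which continuous bounded
functionals keep the eventual upper bounds of their `P n`-means (`hle`), whose joint one-time laws
at rational times are the law of `(û, ‖u‖²)` under a finite measure `μ` on `H` (`hjoint`), and
let the level laws `P n` satisfy the ENERGY LINK (`henergy`). Then for `Q̃.map Prod.fst`-a.e.
path `ω`, every family of `L²` fields `v t` with `𝓕(v t) = ω̄(t)` (`t ≥ 0`) has locally finite
enstrophy and satisfies the energy inequality between rational times
`E(v q') + ν ∫_q^{q'} ‖∇v‖² ≤ E(v q) + ∫_q^{q'} (f, v)` (`ν > 0`, `f` smooth). -/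
theorem stub_augLimitEnergyTools (hν : 0 < ν) (hf : IsSmooth f) [IsFiniteMeasure μ] {R : ℝ} {L : (Fin 3 → ℤ) → ℝ} {b : ℝ}
    (Qt : Measure (↥(pathSpace R L : Set (Path (Fin 3))) × ↥((Set.univ : Set ℚ).pi fun _ : ℚ => Set.Icc (0 : ℝ) b))) [IsFiniteMeasure Qt] (P : ℕ →
          Measure (↥(pathSpace R L : Set (Path (Fin 3))) × ↥((Set.univ : Set ℚ).pi fun _ : ℚ => Set.Icc (0 : ℝ) b)))
    (hle : ∀ g : ↥(pathSpace R L : Set (Path (Fin 3))) × ↥((Set.univ : Set ℚ).pi fun _ : ℚ => Set.Icc (0 : ℝ) b) → ℝ, Continuous g → ∀ B : ℝ, (∀ x,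
          |g x| ≤ B) → ∀ C : ℝ,
      (∀ γ : ℝ, 0 < γ → ∀ᶠ n in atTop, ∫ x, g x ∂(P n) ≤ C + γ) → ∫ x, g x ∂Qt ≤ C)
    (hjoint : ∀ q : ℚ, 0 ≤ q →
      Qt.map (fun x => ((fun k : Fin 3 → ℤ => x.1.1 (q, k)), x.2.1 q)) =
        μ.map (fun u : Torus.energySpace (Fin 3) => ((fun k : Fin 3 → ℤ =>
          mFourierCoeff (EuclideanSpace.complexify ∘ (u.1 : UnitAddTorus (Fin 3) → EuclideanSpace ℝ (Fin 3))) k),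
          ‖u‖ ^ 2)))
    (henergy : ∀ (K : ℕ) (q q' : ℚ), 0 ≤ q → q ≤ q' → ∀ γ : ℝ, 0 < γ → ∀ᶠ n in atTop,
      ∫ x, max 0 (x.2.1 q' - x.2.1 q + ∫ τ in (q : ℝ)..q',
          (2 * pathDiss ν K x.1.1 τ -
            2 * ∑' k, (⟪mFourierCoeff (EuclideanSpace.complexify ∘ f) k, pathExt x.1.1 τ k⟫_ℂ).re)) ∂(P n) ≤ γ) :
    ∀ᵐ ω ∂(Qt.map Prod.fst), ∀ v : ℝ → UnitAddTorus (Fin 3) → EuclideanSpace ℝ (Fin 3),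
      (∀ t, 0 ≤ t → MemLp (v t) 2 volume ∧
        ∀ k, mFourierCoeff (EuclideanSpace.complexify ∘ v t) k = pathExt ω.1 t k) →
      (∀ T, 0 < T → ∫⁻ t in Ioo 0 T, eGradNormSq (v t) < ∞) ∧
      (∀ q q' : ℚ, 0 ≤ q → q ≤ q' →
        kineticEnergy (v q') + ν * (∫⁻ τ in Ioo (q : ℝ) q', eGradNormSq (v τ)).toReal ≤
          kineticEnergy (v q) + ∫ τ in (q : ℝ)..q', ∫ x, ⟪f x, v τ x⟫_ℝ) := by
  filter_upwards [ae_pathEnergyIneq hf Qt hle hjoint henergy] with ω hω v hcoef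
  have hmain : ∀ q q' : ℚ, 0 ≤ q → q ≤ q' →
      ∫⁻ τ in Ioo (q : ℝ) q', eGradNormSq (v τ) < ∞ ∧
        kineticEnergy (v q') + ν * (∫⁻ τ in Ioo (q : ℝ) q', eGradNormSq (v τ)).toReal ≤
          kineticEnergy (v q) + ∫ τ in (q : ℝ)..q', ∫ x, ⟪f x, v τ x⟫_ℝ := fun q q' hq hqq =>
    energyIneq_of_pathEnergyIneq hν hf ω.2 hcoef (by exact_mod_cast hq) (by exact_mod_cast hqq)
      fun K => hω K q q' hq hqq
  refine ⟨fun T _ => ?_, fun q q' hq hqq => (hmain q q' hq hqq).2⟩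
  have h := (hmain 0 (Nat.ceil T : ℚ) le_rfl (Nat.cast_nonneg _)).1
  have hT : T ≤ ((Nat.ceil T : ℚ) : ℝ) := by exact_mod_cast Nat.le_ceil T
  have h0 : (((0 : ℚ) : ℝ)) = 0 := Rat.cast_zero
  rw [h0] at h
  exact lt_of_le_of_lt (lintegral_mono_set (Ioo_subset_Ioo le_rfl hT)) h

end Summit.AnomalousDissipation.AnomalousDissipation.Theorems.EnsembleRealization
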